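import Summits.CriticalPhenomena.PercolationContinuityZ3.Theorems.PercNearOneGluingNoHeavyLowerTailCertPositivity
import HarnessLib

/-!
# `NoHeavyLowerTail` (stmt-CriticalPhenomena-4575) — certificate machine, part 5:
# certificates with a CONSTANT (`μ(L) ≤ (p/q) · max_v μ(U_v)`)

Support file (depth prover nh-dp-blobmono gen 3; `--supports stmt-CriticalPhenomena-4575`).  Computable definitions +
soundness; no named facts, no sorries, standard axioms.

The LP certificates of the CIL / one-cut line also come with a constant: `Σ_a w_a m_a(x) (q·L − p·U_{ref a})(x) +
Σ_r w_r m_r(x) (E₃E₄ − E₁E₂)_r(x)` has all coefficients `≤ 0` (e.g. the three-relay event gluing EG₃ with constant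
`5/4` at degree 3, kit j040444, improving the hand constant `4/3` of `…EventGluingThreeFourThirds`).  Scaling the
multiplier weights by `q` on the plus side and by `p` on the minus side reduces this to the machinery of parts 1–3:

* `CertCheck.scaleAl`, `CertCheck.checkCB` — the bucketed kernel check with constant `p/q`;
  `CertCheck.soundC_of_buckets`, `CertCheck.existsC_le_of_sound` — algebraic soundness;
* `CertCells.Cert.checkCB`, `CertCells.Cert.existsC_le`, `CertCells.Cert.existsC_le_of_injective` — the measure
  level: valid rows + all buckets + a positive term ⇒ for every weighted graph and every injective placement of the
  five terminals, `q · μ(L) ≤ p · μ(U_{ref a})` for some multiplier term `a`.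
-/

noncomputable section

namespace Summit.CriticalPhenomena.PercolationContinuityZ3.Theorems

open MeasureTheory Set Filter Literature.Probability.Percolation
open Literature.Probability.LatticeModels (prodBernoulli)
open scoped Classical BigOperators Topology
open PatternCells

namespace CertCheck

variable (x : ℕ → ℝ)

/-- Scale all multiplier weights by `k`. [folklore] -/
def scaleAl (k : ℕ) (al : List ATerm) : List ATerm := al.map fun a => ⟨a.ref, a.mult, k * a.wt⟩

/-- THE BUCKETED CHECK WITH CONSTANT `p/q`: bucket `b` of the domination of `q·(L-parts) + E₃E₄-parts` by
`p·(U-parts) + E₁E₂-parts`. [folklore] -/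
def checkCB (p q nb b : ℕ) (L : List ℕ) (U : ℕ → List ℕ) (rows : List Row) (al : List ATerm) : Bool :=
  dominated (normalize ((plusTerms L rows (scaleAl q al)).filter fun t => bucket nb t == b))
    (normalize ((minusTerms U rows (scaleAl p al)).filter fun t => bucket nb t == b))

/-- The multiplier sums of scaled weights. [folklore] -/
theorem sum_scaleAl (k : ℕ) (al : List ATerm) (f : ℕ → List ℕ → ℝ) :
    ((scaleAl k al).map fun a => (a.wt : ℝ) * f a.ref a.mult).sum =
      (k : ℝ) * (al.map fun a => (a.wt : ℝ) * f a.ref a.mult).sum := by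
  unfold scaleAl
  rw [List.map_map, ← List.sum_map_mul_left]
  congr 1
  refine List.map_congr_left fun a _ => ?_
  simp only [Function.comp, Nat.cast_mul]
  ring

/-- **Soundness of the constant-`p/q` bucketed checker.** [folklore] -/
theorem soundC_of_buckets (hx : ∀ i, 0 ≤ x i) (L : List ℕ) (U : ℕ → List ℕ) (rows : List Row)
    (al : List ATerm) (p q : ℕ) {nb : ℕ} (hnb : 0 < nb)
    (hrows : ∀ r ∈ rows, linEval x r.e1 * linEval x r.e2 ≤ linEval x r.e3 * linEval x r.e4)
    (h : ∀ b < nb, checkCB p q nb b L U rows al = true) :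
    (al.map fun a => (a.wt : ℝ) * evalM x a.mult *
      ((q : ℝ) * linEval x L - (p : ℝ) * linEval x (U a.ref))).sum ≤ 0 := by
  have hdom : evalT x (plusTerms L rows (scaleAl q al)) ≤ evalT x (minusTerms U rows (scaleAl p al)) := by
    rw [evalT_eq_sum_buckets x hnb (plusTerms L rows (scaleAl q al)),
      evalT_eq_sum_buckets x hnb (minusTerms U rows (scaleAl p al))]
    apply List.sum_le_sum
    intro b hb
    have hc := h b (List.mem_range.1 hb)
    have := evalT_le_of_dominated x hx _ _ hc
    rwa [evalT_normalize, evalT_normalize] at this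
  rw [evalT_plusTerms, evalT_minusTerms] at hdom
  have hL : ((scaleAl q al).map fun a => (a.wt : ℝ) * evalM x a.mult * linEval x L).sum =
      (q : ℝ) * (al.map fun a => (a.wt : ℝ) * evalM x a.mult * linEval x L).sum := by
    have := sum_scaleAl q al fun _ m => evalM x m * linEval x L
    simp only [mul_assoc] at this ⊢
    exact this
  have hU : ((scaleAl p al).map fun a => (a.wt : ℝ) * evalM x a.mult * linEval x (U a.ref)).sum =
      (p : ℝ) * (al.map fun a => (a.wt : ℝ) * evalM x a.mult * linEval x (U a.ref)).sum := by
    have := sum_scaleAl p al fun r m => evalM x m * linEval x (U r)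
    simp only [mul_assoc] at this ⊢
    exact this
  rw [hL, hU] at hdom
  have hR : (rows.map fun r => (r.wt : ℝ) * evalM x r.mult * (linEval x r.e1 * linEval x r.e2)).sum ≤
      (rows.map fun r => (r.wt : ℝ) * evalM x r.mult * (linEval x r.e3 * linEval x r.e4)).sum := by
    apply List.sum_le_sum
    intro r hr
    exact mul_le_mul_of_nonneg_left (hrows r hr) (mul_nonneg (Nat.cast_nonneg _) (evalM_nonneg x hx _))
  have key : (q : ℝ) * (al.map fun a => (a.wt : ℝ) * evalM x a.mult * linEval x L).sum -
      (p : ℝ) * (al.map fun a => (a.wt : ℝ) * evalM x a.mult * linEval x (U a.ref)).sum ≤ 0 := by linarith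
  have heq : (al.map fun a => (a.wt : ℝ) * evalM x a.mult *
      ((q : ℝ) * linEval x L - (p : ℝ) * linEval x (U a.ref))).sum =
      (q : ℝ) * (al.map fun a => (a.wt : ℝ) * evalM x a.mult * linEval x L).sum -
        (p : ℝ) * (al.map fun a => (a.wt : ℝ) * evalM x a.mult * linEval x (U a.ref)).sum := by
    rw [← List.sum_map_mul_left, ← List.sum_map_mul_left, sum_map_sub]
    congr 1
    refine List.map_congr_left fun a _ => ?_
    ring
  rw [heq]
  exact key

/-- From the weighted sum to one reference, with the constant. [folklore] -/
theorem existsC_le_of_sound (hx : ∀ i, 0 ≤ x i) (L : List ℕ) (U : ℕ → List ℕ) (al : List ATerm) (p q : ℕ)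
    (hsum : (al.map fun a => (a.wt : ℝ) * evalM x a.mult *
      ((q : ℝ) * linEval x L - (p : ℝ) * linEval x (U a.ref))).sum ≤ 0)
    (hpos : ∃ a ∈ al, 0 < (a.wt : ℝ) * evalM x a.mult) :
    ∃ a ∈ al, (q : ℝ) * linEval x L ≤ (p : ℝ) * linEval x (U a.ref) := by
  by_contra hcon
  push Not at hcon
  obtain ⟨a₀, ha₀, hpos₀⟩ := hpos
  have hnn : ∀ a ∈ al, 0 ≤ (a.wt : ℝ) * evalM x a.mult *
      ((q : ℝ) * linEval x L - (p : ℝ) * linEval x (U a.ref)) :=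
    fun a ha => mul_nonneg (mul_nonneg (Nat.cast_nonneg _) (evalM_nonneg x hx _)) (by linarith [hcon a ha])
  have hmem : (a₀.wt : ℝ) * evalM x a₀.mult * ((q : ℝ) * linEval x L - (p : ℝ) * linEval x (U a₀.ref)) ∈
      al.map fun a => (a.wt : ℝ) * evalM x a.mult * ((q : ℝ) * linEval x L - (p : ℝ) * linEval x (U a.ref)) :=
    List.mem_map.2 ⟨a₀, ha₀, rfl⟩
  have hposterm : 0 < (a₀.wt : ℝ) * evalM x a₀.mult *
      ((q : ℝ) * linEval x L - (p : ℝ) * linEval x (U a₀.ref)) :=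
    mul_pos hpos₀ (by linarith [hcon a₀ ha₀])
  have hlt := lt_of_lt_of_le hposterm (List.single_le_sum (fun y hy => by
      obtain ⟨a, ha, rfl⟩ := List.mem_map.1 hy; exact hnn a ha) _ hmem)
  linarith

end CertCheck

namespace CertCells

open CertCheck

variable {n : ℕ}

/-- The bucketed kernel check of a certificate with constant `p/q`. [folklore] -/
def Cert.checkCB (C : Cert) (p q nb b : ℕ) : Bool :=
  CertCheck.checkCB p q nb b (cellsOf C.L) C.Ucells (C.rows.map RowSpec.toRow) C.al

/-- **Measure-level soundness with constant.** [folklore] -/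
theorem Cert.existsC_le (C : Cert) (hvalid : C.rowsValid = true) (p q : ℕ) {nb : ℕ} (hnb : 0 < nb)
    (hcheck : ∀ b < nb, C.checkCB p q nb b = true) (w : Sym2 (Fin n) → unitInterval) (v : Fin 5 → Fin n)
    (hpos : ∃ a ∈ C.al, 0 < (a.wt : ℝ) * evalM (fun m => (prodBernoulli w).real (Cell v m)) a.mult) :
    ∃ a ∈ C.al, (q : ℝ) * (prodBernoulli w).real (C.L.set v) ≤
      (p : ℝ) * (prodBernoulli w).real ((C.U.getD a.ref []).set v) := by
  have hx : ∀ i, 0 ≤ (fun m => (prodBernoulli w).real (Cell v m)) i := fun _ => measureReal_nonneg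
  have hrows : ∀ r ∈ C.rows.map RowSpec.toRow,
      linEval (fun m => (prodBernoulli w).real (Cell v m)) r.e1 *
          linEval (fun m => (prodBernoulli w).real (Cell v m)) r.e2 ≤
        linEval (fun m => (prodBernoulli w).real (Cell v m)) r.e3 *
          linEval (fun m => (prodBernoulli w).real (Cell v m)) r.e4 := by
    intro r hr
    obtain ⟨s, hs, rfl⟩ := List.mem_map.1 hr
    unfold Cert.rowsValid at hvalid
    exact RowSpec.holds s ((List.all_eq_true.1 hvalid) s hs) w v
  have hs := soundC_of_buckets (fun m => (prodBernoulli w).real (Cell v m)) hx (cellsOf C.L) C.Ucells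
    (C.rows.map RowSpec.toRow) C.al p q hnb hrows hcheck
  have := existsC_le_of_sound (fun m => (prodBernoulli w).real (Cell v m)) hx (cellsOf C.L) C.Ucells C.al p q
    hs hpos
  simpa [Cert.Ucells, measureReal_set_eq_linEval] using this

/-- **The certificate theorem with constant.**  Valid rows + all buckets of `checkCB p q` + a positive term on
consistent cells ⇒ for every weighted graph and every injective placement of the five terminals,
`q · μ(L) ≤ p · μ(U_{ref a})` for some multiplier term `a`. [folklore] -/
theorem Cert.existsC_le_of_injective (C : Cert) (hvalid : C.rowsValid = true) (p q : ℕ) {nb : ℕ} (hnb : 0 < nb)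
    (hcheck : ∀ b < nb, C.checkCB p q nb b = true) (hterm : C.posTerm = true)
    (w : Sym2 (Fin n) → unitInterval) {v : Fin 5 → Fin n} (hv : Function.Injective v) :
    ∃ a ∈ C.al, (q : ℝ) * (prodBernoulli w).real (C.L.set v) ≤
      (p : ℝ) * (prodBernoulli w).real ((C.U.getD a.ref []).set v) := by
  obtain ⟨a₀, ha₀, hwa⟩ := List.any_eq_true.1 hterm
  rw [Bool.and_eq_true, decide_eq_true_eq, List.all_eq_true] at hwa
  obtain ⟨hwt, hmult⟩ := hwa
  have hk : ∀ k, ∃ a ∈ C.al, (q : ℝ) * (prodBernoulli (mixW w k)).real (C.L.set v) ≤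
      (p : ℝ) * (prodBernoulli (mixW w k)).real ((C.U.getD a.ref []).set v) := by
    intro k
    refine C.existsC_le hvalid p q hnb hcheck (mixW w k) v ⟨a₀, ha₀, mul_pos (by exact_mod_cast hwt) ?_⟩
    unfold evalM
    refine List.prod_pos fun y hy => ?_
    obtain ⟨c, hc, rfl⟩ := List.mem_map.1 hy
    have hc' : c ∈ consPatterns := by simpa using hmult c hc
    exact cell_pos (mixW w k) (fun e _ => mixW_pos_lt_one w k e) hv hc'
  by_contra hcon
  push Not at hcon
  have hev : ∀ a ∈ C.al.toFinset, ∀ᶠ k in atTop,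
      (p : ℝ) * (prodBernoulli (mixW w k)).real ((C.U.getD a.ref []).set v) <
        (q : ℝ) * (prodBernoulli (mixW w k)).real (C.L.set v) := by
    intro a ha
    exact ((((stub_weightContinuity n _).tendsto w).comp (tendsto_mixW w)).const_mul (p : ℝ)).eventually_lt
      ((((stub_weightContinuity n _).tendsto w).comp (tendsto_mixW w)).const_mul (q : ℝ))
      (hcon a (List.mem_toFinset.1 ha))
  obtain ⟨k, hk'⟩ := ((Finset.eventually_all _).2 hev).exists
  obtain ⟨a, ha, hle⟩ := hk k
  exact absurd hle (not_le.2 (hk' a (List.mem_toFinset.2 ha)))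

/-! ## Unfolding a symmetric certificate inside Lean

LP certificates are found folded under the symmetry group of the target (permutations of equal-mass relays).  To
keep the data files small the group acts in Lean: `permPattern` on cell patterns, `ATerm.permute` /
`RowSpec.permute` on the data, `unfoldAl` / `unfoldRows` produce the full lists (a representative of weight `w`
contributes `w` under every group element; orbit multiplicities are absorbed in the weights by the generator).
No soundness statement is needed: the unfolded lists are what `Cert` checks. -/

/-- The image of a connection pattern under a permutation of the five terminals. [folklore] -/
def permPattern (σ : Fin 5 → Fin 5) (m : ℕ) : ℕ :=
  (List.finRange 5).foldl (fun acc i => (List.finRange 5).foldl (fun acc' j =>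
    bif decide (i < j) && Nat.testBit m (pairIdx i j) then acc' + 2 ^ pairIdx (σ i) (σ j) else acc') acc) 0

/-- Sort a monomial (the checker groups equal monomials only if they are listed in the same order; the data
generators emit sorted monomials, and permuted monomials are re-sorted here). [folklore] -/
def sortMono (l : List ℕ) : List ℕ := l.foldr monoIns []

/-- Permute a reference index (a terminal number stored as `ℕ`). [folklore] -/
def permRef (σ : Fin 5 → Fin 5) (r : ℕ) : ℕ := if h : r < 5 then (σ ⟨r, h⟩).val else r

/-- Permute a multiplier term. [folklore] -/
def permATerm (σ : Fin 5 → Fin 5) (a : ATerm) : ATerm :=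
  ⟨permRef σ a.ref, sortMono (a.mult.map (permPattern σ)), a.wt⟩

/-- Permute a row spec. [folklore] -/
def RowSpec.permute (σ : Fin 5 → Fin 5) : RowSpec → RowSpec
  | .ts a T O P m w =>
    .ts (σ a) (T.map σ) (O.map σ) (P.map fun p => (σ p.1, σ p.2)) (sortMono (m.map (permPattern σ))) w
  | .kn x T O Lp P m w =>
    .kn (σ x) (T.map σ) (O.map σ) (Lp.map fun p => (σ p.1, σ p.2)) (P.map fun p => (σ p.1, σ p.2))
      (sortMono (m.map (permPattern σ))) w

/-- Unfold multiplier terms under a list of terminal permutations. [folklore] -/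
def unfoldAl (G : List (Fin 5 → Fin 5)) (al : List ATerm) : List ATerm :=
  al.flatMap fun a => G.map fun σ => permATerm σ a

/-- Unfold row specs under a list of terminal permutations. [folklore] -/
def unfoldRows (G : List (Fin 5 → Fin 5)) (rows : List RowSpec) : List RowSpec :=
  rows.flatMap fun r => G.map fun σ => r.permute σ

end CertCells

end Summit.CriticalPhenomena.PercolationContinuityZ3.Theorems

end
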